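import Literature.MathematicalPhysics.QuantumFieldTheory.Balaban1983to89.Node00.CarriersB13KernelTower
import Literature.MathematicalPhysics.QuantumFieldTheory.Balaban1983to89.B13ChainJointNonvacuityPrefactors
import Literature.MathematicalPhysics.QuantumFieldTheory.Balaban1983to89.B16Ineq197ClassOne

/-!
# `Balaban1983to89.B13CountBinderObstruction` — T. Bałaban, *Renormalization group approach to lattice gauge field theories.
II. Cluster expansions*, Commun. Math. Phys. **116** (1988) 1–22, doi:10.1007/bf01239022 [Balaban1988RG2Cluster]:
**THE COUNT-BINDER OBSTRUCTION TO A JOINT INHABITANT OF THE N10 JUNCTION OF RECORD — which constants records can carry ONE datum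
meeting ALL binders of the kernel-tower junctions 67 ∕ 67R ∕ 67RD ∕ 67RDL at once, and why none of the tree's numerical witnesses can**

statement-level skeleton of published theorems with citation tags; proofs where landed; nothing here is a claim about the
Yang–Mills mass gap

CITATION HEADER (verbatim).  p. 12 [PDF 12], (2.3): *"Here the symbol |P| means the number of bonds in the set P"*; p. 14, (2.9): *"H(Z) =
Σ_{Z₀ : Z′₀ ⊂ Z} H(Z, Z₀)"* — the sum over the terms `(𝐃, P)`; p. 17 [PDF 17], (2.24)–(2.26) and p. 20 [PDF 20], before (2.37): the volume factor of a
term is *"exp O(1)(LM)⁴α₅|Z|"*-type with *"O(1)(LM)⁴α₅ + exp(−½(κ₁ − 1)) … sufficiently small"* — the count is DIAL-WEIGHTED (`α₅` small); p. 21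
[PDF 21], closing paragraph: *"The assumptions allow finally us to fix all the constants, or rather bounds on these constants."*  NOT PRINTED: every
explicit number below — arithmetic on TYPED hypothesis lists of the cell's junction modules, not Bałaban's constants.

WHY THIS FILE (cell `pub-ymgap`, HUMAN RULING D-0062 Track A ∕ D-0149 width seats, node N10 = [B13], seat `pub-ymgap-dag-n10-w3` g4; own-stem
successor of this seat's joint NUMERICAL witnesses `B13ChainJointNonvacuityPrefactors(Bond)` (p607038 ∕ p608206 ∕ p609427) — their HONEST SCOPE said: *«a
single inhabitant of all ≈ 160 binders of the junction is NOT claimed»*; n10-w4 g3's all-located edition 67RDL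
(`Summits/…/BalabanUVNodesN10B13KernelTowerWalksEntrywiseNumeralsDecoratedDialsLocated`) said: *«no single inhabitant of all binders at once»*).
Trying to BUILD that joint inhabitant one meets an ARITHMETIC obstruction that sits in THREE binders of the junction and nowhere else:
* `hN : Lemma3Numerics (c13OfRecord θ layer) (m₃+1) ((ℓ₆+1)∕2) a a₂ a₂′ a₅ A_abs` — its fields `habs : a₅ + e^{−(κ₁−1)∕2} ≤ A_abs` and
  `hAc : 64·A_abs ≤ δ·ℓ·κ` give `a₅ < δ·ℓ·κ∕64` (§1);
* `hPcard : ∀ Z, ∀ t ∈ terms L (m₃+1) Z, (Pl Z t).card = t.2.card` — the row-bond index `Λ` of the term's kernel record carries a finset of the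
  cardinality of the term's bond family `P = t.2`, so `card Λ ≥ |P|`;
* `hcount : ∀ Z, ∀ t ∈ terms …, 2·card Λ + ½·card(Λ ⊕ C₀) + 2K₀(64,8)α₄·#⋃𝐃 ≤ a₅·|Z|` — the θ-FREE count form in which module 67
  (`…EntrywiseNumeralsDecorated`, and its located editions 67R ∕ 67RD ∕ 67RDL) displays the volume binder: n10-w1's honest coarsening
  `B13Bound226Numerals.vol_of_counts` of the DIAL-WEIGHTED binder `hvol` of the earlier junctions (51C ∕ 32), whose per-row-bond coefficients
  (`x(1 + (1−x)⁻¹)` with `x ∝ θ₀`, and `A·c_E`, `A·V` with `A = 2θ·fib + γ₂ + 2m′α₄M⁻⁴(1 + 32∕(κ₁−1))⁴`) were frozen at their worst cases `3∕2, ½, ½`.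
At `Z :=` the whole coarse torus and the admissible term `t⋆ := (∅, ALL bonds)` (§2: it IS a member of `terms L M Z`, (2.9)'s index set as typed by
`B13Lemma3TorusTerms.IsTerm`), `hPcard ∧ hcount` force `10·M⁴·L⁴ ≤ a₅` (`M = m₃ + 1` the bond fineness, `L = θ.ℓ₆ + 1` the block size), hence with `hN`:
**`1280·(m₃+1)⁴·(ℓ₆+1)³ < c.δ·c.κ`** (§3).  Every numerics witness of the N10 chain in the tree — lit-balaban's `B13Lemma3TorusNonvacuity.consts`, n10-w1's
`B13ChainJointNonvacuity226.constsQ8 M`, this seat's `B13ChainJointNonvacuityPrefactors.constsQ8A M α₄` — has `δ = 3∕40` and `κ = κw = 20(κ₀(64,8) + 64) <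
8960`, so `δκ < 672` (§4): at these constants NO kernel tower, for NO `θ`, NO torus size and NO bond fineness, meets `hN ∧ hPcard ∧ hcount`.  So the
junction's «joint numerical witnesses» live where its OBJECT binders are unsatisfiable — an A6 statement AS TYPED (director-ym №189 class) about
67 ∕ 67R ∕ 67RD ∕ 67RDL, with its repair LOCATED (§5): the dial-weighted count.  NOTHING here is about print: p. 20's factor is `O(1)(LM)⁴α₅` with `α₅`
SMALL — exactly the dial-weighted `hvol`; the obstruction is an artefact of displaying the θ-free coarsening as THE binder (and, downstream, of 67RD's
`θ₀ := θ₀max`, harmless for 67-as-typed since `hcount` hides the θ₀-dependence).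

WHAT THIS FILE PROVES (0 `sorry`, 0 `def`; theorems only).
§1 `a5_lt_of_numerics` — `Lemma3Numerics c M ℓ a a₂ a₂′ a₅ A_abs → a₅ < c.δ·ℓ·c.κ∕64`.
§2 torus bookkeeping for (2.9)'s index set: `isTDom_univ` (the whole torus is a localization domain), `univ_mem_terms` (`(∅, univ) ∈ terms L M ⟨univ, _⟩`:
   every bond may be a `P`-bond of the term with empty 𝐃 over the whole torus), `card_tPt`, `card_tBond` (`|bonds| = d·(M·N)ᵈ`).
§3 AT THE JUNCTION'S BINDER TEXTS (a kernel tower `lamK : Node00.ResidB13K θ`; the binders `hN hα hPcard hcount` VERBATIM those of 67RDL with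
   `lamD.toC.toK ↦ lamK`): ★ `ten_mul_pow_le_a5_of_count_binders` (`10·(m₃+1)⁴·(ℓ₆+1)⁴ ≤ a₅`), ★★ `delta_kappa_floor_of_count_binders`
   (`1280·(m₃+1)⁴·(ℓ₆+1)³ < lamK.c.δ·lamK.c.κ`), ★★★ `count_binders_false_of_delta_kappa_le` (`lamK.c.δ·lamK.c.κ ≤ 1280 ⟹` the four binders are jointly
   `False`).
§4 AT THE TREE'S WITNESS FAMILIES: `log_162_lt_six`, `κw_lt` (`κw < 8960`), `δw_mul_κw_lt` (`δw·κw < 672`), ★★★ `no_joint_inhabitant_of_witness_constants`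
   (`lamK.c.δ = δw → lamK.c.κ = κw →` no letters `a a₂ a₂′ a₅ A_abs` meet `hN ∧ hα ∧ hPcard ∧ hcount`), and the named instances `…_consts`, `…_constsQ8`,
   `…_constsQ8A` (the three families of record).
§5 THE LOCATED REPAIR IN KERNEL FORM: `dialCount_le_of_dials` — a count whose per-index coefficients are the DIALS (`θ₀`-, `γ₂`-, `α₄`-weighted, the
   shape of 51C's `hvol` ∕ of `vol_of_counts`' left side) is met for ARBITRARY finite object sizes as soon as the dials are small against `a₅ ∕ (3·sizes)`;
   i.e. with `hvol` displayed (or `hcount` keeping the dial coefficients) and `θ₀ ≤ θ₀max` left free, the count binder no longer pins `δκ`.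

HONEST SCOPE.  Elementary real arithmetic + finite-torus bookkeeping over CITED tree definitions (`Lemma3Numerics`, `terms ∕ IsTerm`, `ResidB13K`, the
three constants records); a statement about WHICH TYPED CONSTANTS RECORDS can carry a joint inhabitant of the junction's hypothesis list — nothing of
Bałaban's is asserted or denied, print's (2.24)–(2.26) ∕ p. 20 count is dial-weighted and untouched, 51C ∕ 32 ∕ n10-b's chain, `vol_of_counts` and every
landed witness remain TRUE AS STATED (their honest scopes never claimed the object binders).  Whether some OTHER constants record (with `δκ > 1280·M⁴L³`,
e.g. `κ ≳ 10⁷` at `δ = 3∕40`) meets all 69 + 38 numerical conjuncts is NOT decided here (located: `B13Lemma3WindowNonvacuity`'s letters scale — `a`, `κ₁`,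
`A₁`, `ε₁` move with `κ`).  Count-neutral; N10 NOT discharged; K1⁷ NOT claimed; one finite four-torus programme at fixed ε; nothing continuum ∕ ℝ⁴ ∕
OS ∕ mass-gap ∕ Clay.
-/

noncomputable section

namespace Literature.MathematicalPhysics.QuantumFieldTheory.Balaban1983to89.B13CountBinderObstruction

open Literature.MathematicalPhysics.QuantumFieldTheory.Balaban1983to89
open Literature.MathematicalPhysics.QuantumFieldTheory.Balaban1983to89.B13ScaleTransfer (Pt FaceConnected)
open Literature.MathematicalPhysics.QuantumFieldTheory.Balaban1983to89.TreeLengthTorus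
  (TPt TDom IsTDom TFaceConnected proj natLift proj_natLift tFaceConnected_image)
open Literature.MathematicalPhysics.QuantumFieldTheory.Balaban1983to89.TreeLengthTorusTransfer (tclosure tcoarse)
open Literature.MathematicalPhysics.QuantumFieldTheory.Balaban1983to89.B13Lemma3TorusData (TBond ttouch tbondEnd)
open Literature.MathematicalPhysics.QuantumFieldTheory.Balaban1983to89.B13Lemma3TorusTerms (terms mem_terms IsTerm Z0 Y0 cubesP)
open Literature.MathematicalPhysics.QuantumFieldTheory.Balaban1983to89.B13Lemma3TorusSocket (Lemma3Numerics)
open Literature.MathematicalPhysics.QuantumFieldTheory.Balaban1983to89.B12TreeDecay (kappa₀ K₀ K₀_pos)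
open Literature.MathematicalPhysics.QuantumFieldTheory.Balaban1983to89.B16Absorption (pbox mem_pbox)
open Literature.MathematicalPhysics.QuantumFieldTheory.Balaban1983to89.B16Ineq197ClassOne (faceConnected_pbox)
open Literature.MathematicalPhysics.QuantumFieldTheory.Balaban1983to89.B13Lemma3WindowNonvacuity (κw κ₀w δw)
open Literature.MathematicalPhysics.QuantumFieldTheory.Balaban1983to89.B13Lemma3TorusNonvacuity (consts)
open Literature.MathematicalPhysics.QuantumFieldTheory.Balaban1983to89.B13ChainJointNonvacuity226 (constsQ8)
open Literature.MathematicalPhysics.QuantumFieldTheory.Balaban1983to89.B13ChainJointNonvacuityPrefactors (constsQ8A)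
open Literature.MathematicalPhysics.QuantumFieldTheory.Balaban1983to89.Node00

/-! ## §1. The volume letter `a₅` is capped by `δ·ℓ·κ∕64` under the Lemma-3 numerics bundle -/

section Numerics

/-- **`hN` caps the volume letter: `a₅ < δ·ℓ·κ∕64`.**  From two of the 25 restrictions of `Lemma3Numerics` — `habs : a₅ + e^{−(κ₁−1)∕2} ≤ A_abs`
(p. 20: *"O(1)(LM)⁴α₅ + exp(−½(κ₁ − 1)) is sufficiently small"*) and `hAc : 64·A_abs ≤ δ·ℓ·κ` (its absorption into the tree-decay rate `δℓκ`).
[cite: Balaban1988RG2Cluster, p.20 (before (2.37)) and Lemma 3 p.20] -/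
theorem a5_lt_of_numerics {c : B13.Consts} {M : ℕ} {ℓ a a₂ a₂' a₅ Aabs : ℝ} (hN : Lemma3Numerics c M ℓ a a₂ a₂' a₅ Aabs) :
    a₅ < c.δ * ℓ * c.κ / 64 := by
  have h₁ := hN.habs
  have h₂ := hN.hAc
  have h₃ := Real.exp_pos (-((c.κ₁ - 1) / 2))
  have h₄ : Aabs ≤ c.δ * ℓ * c.κ / 64 := by
    rw [le_div_iff₀ (by norm_num : (0 : ℝ) < 64)]
    linarith
  linarith

/-- The cap in the junction's arity: with `ℓ := L∕2` (`L = θ.ℓ₆ + 1` as a real), `a₅ < δ·L·κ∕128`. [cite: Balaban1988RG2Cluster, p.20 (before (2.37))] -/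
theorem a5_lt_of_numerics_half {c : B13.Consts} {M : ℕ} {L a a₂ a₂' a₅ Aabs : ℝ} (hN : Lemma3Numerics c M (L / 2) a a₂ a₂' a₅ Aabs) :
    a₅ < c.δ * L * c.κ / 128 := by
  have h := a5_lt_of_numerics hN
  have : c.δ * (L / 2) * c.κ / 64 = c.δ * L * c.κ / 128 := by ring
  linarith

end Numerics

/-! ## §2. Torus bookkeeping for (2.9)'s index set: the whole torus is a domain, and `(∅, all bonds)` is a term over it -/

section Torus

variable {d : ℕ}

/-- The cubes of the torus with `N` cubes per direction are the projections of the box `[0, N−1]ᵈ ⊂ ℤᵈ`; private plumbing. [folklore] -/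
private theorem image_proj_pbox_eq_univ (N : ℕ) [NeZero N] :
    (pbox (fun _ : Fin d => (0 : ℤ)) (fun _ => ((N : ℤ) - 1))).image (proj N) = (Finset.univ : Finset (TPt d N)) := by
  classical
  refine Finset.eq_univ_iff_forall.2 fun a => Finset.mem_image.2 ⟨natLift a, ?_, proj_natLift a⟩
  refine mem_pbox.2 fun i => ?_
  have hlt : (a i).val < N := ZMod.val_lt (a i)
  refine ⟨?_, ?_⟩
  · show (0 : ℤ) ≤ ((a i).val : ℤ)
    exact_mod_cast Nat.zero_le _
  · show ((a i).val : ℤ) ≤ (N : ℤ) - 1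
    have : ((a i).val : ℤ) < (N : ℤ) := by exact_mod_cast hlt
    omega

/-- **The whole torus `π_j` is a localization domain** (non-empty and face-connected: the projection of the face-connected box `[0, N−1]ᵈ`,
`B16Ineq197ClassOne.faceConnected_pbox` + `TreeLengthTorus.tFaceConnected_image`).  Bookkeeping for (2.9)'s sum over `Z ∈ 𝐃_{k+1}`.
[cite: Balaban1987RG1, p.257 (localization domains); Balaban1988RG2Cluster, (2.9) p.14, bookkeeping] -/
theorem isTDom_univ (N : ℕ) [NeZero N] : IsTDom (Finset.univ : Finset (TPt d N)) := by
  classical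
  refine ⟨⟨fun _ => 0, Finset.mem_univ _⟩, ?_⟩
  rw [← image_proj_pbox_eq_univ (d := d) N]
  exact tFaceConnected_image (faceConnected_pbox _ _)

/-- `|π| = Nᵈ` cubes on the torus with `N` cubes per direction. [cite: Balaban1988RG2Cluster, (2.9) p.14, bookkeeping] -/
theorem card_tPt (N : ℕ) [NeZero N] : Fintype.card (TPt d N) = N ^ d := by
  classical
  rw [Fintype.card_fun, ZMod.card, Fintype.card_fin]

/-- `|bonds| = d·(M·N)ᵈ` on the unit torus with `M·N` sites per direction ((2.3): *"the symbol |P| means the number of bonds in the set P"*).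
[cite: Balaban1988RG2Cluster, (2.3) p.12, bookkeeping] -/
theorem card_tBond (M N : ℕ) [NeZero M] [NeZero N] : Fintype.card (TBond d M N) = (M * N) ^ d * d := by
  classical
  rw [Fintype.card_prod, card_tPt, Fintype.card_fin]

variable {L N' M : ℕ} [NeZero L] [NeZero N'] [NeZero M]

/-- **`(∅, ALL bonds)` IS A TERM OVER THE WHOLE TORUS**: in (2.9)'s index set as typed (`IsTerm`: every `P`-bond leaves `Y₀`, `Z₀ ≠ ∅`, `Z′₀ ⊆ Z`), the
pair `𝐃 = ∅`, `P = every bond of T₁^{(k)}` is admissible for `Z = π_{k+1}` (whole coarse torus): `Y₀ = ∅`, `Z₀ =` every cube, `Z′₀ ⊆ π`.  This is the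
term at which the junction's count binder is read below (`0 < d` supplies a bond).
[cite: Balaban1988RG2Cluster, (2.3) p.12 and (2.9) p.14] -/
theorem univ_mem_terms (hd : 0 < d) :
    ((∅, Finset.univ) : Finset (TDom d (L * N')) × Finset (TBond d M (L * N'))) ∈
      terms L M (⟨Finset.univ, isTDom_univ N'⟩ : TDom d N') := by
  classical
  rw [mem_terms]
  refine ⟨fun b _ hsub => ?_, ?_, fun _ _ => Finset.mem_univ _⟩
  · -- `Y₀(∅) = ∅` while a bond meets the cube of its initial site
    have hmem : tcoarse M (L * N') b.1 ∈ ttouch M (L * N') b := by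
      simp [ttouch]
    have h := hsub hmem
    simp [Y0] at h
  · -- `Z₀ ⊇` the cubes met by the bond at the origin in direction `0`
    refine ⟨tcoarse M (L * N') (fun _ => 0), Finset.mem_union_right _ ?_⟩
    refine Finset.mem_biUnion.2 ⟨((fun _ => 0), ⟨0, hd⟩), Finset.mem_univ _, ?_⟩
    simp [ttouch]

end Torus

/-! ## §3. At the junction's binder texts: `hN ∧ hα ∧ hPcard ∧ hcount` force `1280·(m₃+1)⁴·(ℓ₆+1)³ < δ·κ` -/

section Junction

variable (θ : Stage3Params) (lamK : ResidB13K θ)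

/-- The arithmetic of the count at one term, abstractly: a finset of the row-bond index of cardinality `B` (`hPcard`), the count charging `2` per
row bond and `½` per element of `Λ ⊕ C₀` plus a non-negative 𝐃-summand (`hcount`) ⟹ `(5∕2)·B ≤ a₅·|Z|`; private plumbing. [folklore] -/
private theorem count_core {ΛT C₀T : Type} [Fintype ΛT] [Fintype C₀T] {B : ℕ} (s : Finset ΛT) (hs : s.card = B)
    {a₅ Zc D : ℝ} (hD : 0 ≤ D) (hc : 2 * (Fintype.card ΛT : ℝ) + (Fintype.card (ΛT ⊕ C₀T) : ℝ) / 2 + D ≤ a₅ * Zc) :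
    (5 / 2 : ℝ) * (B : ℝ) ≤ a₅ * Zc := by
  have h₁ : B ≤ Fintype.card ΛT := hs ▸ Finset.card_le_univ s
  have h₁r : (B : ℝ) ≤ (Fintype.card ΛT : ℝ) := by exact_mod_cast h₁
  have h₂ : (Fintype.card ΛT : ℝ) ≤ (Fintype.card (ΛT ⊕ C₀T) : ℝ) := by
    rw [Fintype.card_sum]
    push_cast
    linarith [(Nat.cast_nonneg (Fintype.card C₀T) : (0 : ℝ) ≤ (Fintype.card C₀T : ℝ))]
  linarith

/-- The arithmetic of the division by the torus volume: `(5∕2)·(4·(M·L·N)⁴) ≤ a₅·N⁴`, `N > 0` ⟹ `10·M⁴·L⁴ ≤ a₅`; private plumbing. [folklore] -/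
private theorem div_core {M L N a₅ : ℝ} (hN : 0 < N) (h : (5 / 2 : ℝ) * ((M * (L * N)) ^ 4 * 4) ≤ a₅ * N ^ 4) :
    10 * (M ^ 4 * L ^ 4) ≤ a₅ := by
  have hN4 : (0 : ℝ) < N ^ 4 := by positivity
  have : (10 * (M ^ 4 * L ^ 4)) * N ^ 4 ≤ a₅ * N ^ 4 := by
    have e : (5 / 2 : ℝ) * ((M * (L * N)) ^ 4 * 4) = (10 * (M ^ 4 * L ^ 4)) * N ^ 4 := by ring
    linarith
  exact le_of_mul_le_mul_right this hN4

open Classical in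
/-- ★ **THE COUNT AT THE UNIVERSAL TERM: `10·(m₃+1)⁴·(ℓ₆+1)⁴ ≤ a₅`.**  Read the junction's binders `hPcard` and `hcount` (VERBATIM the texts of
67 ∕ 67R ∕ 67RD ∕ 67RDL, keyed on a kernel tower `lamK` — there `lamD.toC.toK`) at `Z :=` the whole coarse torus (`(n+1)⁴` cubes) and the term
`t⋆ := (∅, all bonds)` (`univ_mem_terms`; `4·((m₃+1)(ℓ₆+1)(n+1))⁴` bonds): `hPcard` makes the kernel's row-bond index `Λ` at least as large as `P = t⋆.2`,
`hcount` charges `2` per element of `Λ` and `½` per element of `Λ ⊕ C₀` against `a₅·|Z|`; the 𝐃-summand is `≥ 0` (`hα`).  Dividing by `(n+1)⁴`.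
[cite: Balaban1988RG2Cluster, (2.3) p.12, (2.9) p.14, (2.24)–(2.26) p.17, p.20 (before (2.37))] -/
theorem ten_mul_pow_le_a5_of_count_binders {a₅ : ℝ} (hα : 0 < lamK.layer.c.α₄)
    (hPcard : ∀ Z, ∀ t ∈ terms (θ.ℓ₆ + 1) (lamK.layer.m₃ + 1) Z, (lamK.Pl Z t).card = t.2.card)
    (hcount : ∀ Z, ∀ t ∈ terms (θ.ℓ₆ + 1) (lamK.layer.m₃ + 1) Z,
      2 * (Fintype.card (lamK.𝒦 Z t).Λ : ℝ) + (Fintype.card ((lamK.𝒦 Z t).Λ ⊕ (lamK.𝒦 Z t).C₀) : ℝ) / 2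
        + 2 * (K₀ 64 8 * lamK.layer.c.α₄ * ((((t.1).image Subtype.val).biUnion id).card : ℝ)) ≤ a₅ * ((Z.1).card : ℝ)) :
    10 * (((lamK.m₃ : ℝ) + 1) ^ 4 * (((θ.ℓ₆ : ℝ) + 1) ^ 4)) ≤ a₅ := by
  -- the universal datum: whole coarse torus, empty 𝐃, every bond in P
  have hmem := univ_mem_terms (d := 4) (L := θ.ℓ₆ + 1) (N' := lamK.n + 1) (M := lamK.layer.m₃ + 1) (by norm_num : 0 < 4)
  have hP := hPcard _ _ hmem
  have hc := hcount _ _ hmem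
  have hD : (0 : ℝ) ≤ 2 * (K₀ 64 8 * lamK.layer.c.α₄ *
      ((((((∅, Finset.univ) : Finset (TDom 4 ((θ.ℓ₆ + 1) * (lamK.n + 1))) ×
        Finset (TBond 4 (lamK.layer.m₃ + 1) ((θ.ℓ₆ + 1) * (lamK.n + 1)))).1).image Subtype.val).biUnion id).card : ℝ)) := by
    have := K₀_pos 64 8
    positivity
  have key := count_core _ hP hD hc
  -- the two sizes
  have hB : (((∅, Finset.univ) : Finset (TDom 4 ((θ.ℓ₆ + 1) * (lamK.n + 1))) ×
      Finset (TBond 4 (lamK.layer.m₃ + 1) ((θ.ℓ₆ + 1) * (lamK.n + 1)))).2).card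
        = ((lamK.layer.m₃ + 1) * ((θ.ℓ₆ + 1) * (lamK.n + 1))) ^ 4 * 4 := by
    show (Finset.univ : Finset (TBond 4 (lamK.layer.m₃ + 1) ((θ.ℓ₆ + 1) * (lamK.n + 1)))).card = _
    rw [Finset.card_univ, card_tBond]
  have hZ : ((⟨Finset.univ, isTDom_univ (lamK.n + 1)⟩ : TDom 4 (lamK.n + 1)).1).card = (lamK.n + 1) ^ 4 := by
    show (Finset.univ : Finset (TPt 4 (lamK.n + 1))).card = _
    rw [Finset.card_univ, card_tPt]
  rw [hB, hZ] at key
  have hm : lamK.layer.m₃ = lamK.m₃ := rfl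
  rw [hm] at key
  push_cast at key
  exact div_core (by positivity) key

open Classical in
/-- ★★ **THE `δκ`-FLOOR OF A JOINT INHABITANT: `1280·(m₃+1)⁴·(ℓ₆+1)³ < δ·κ`.**  The four binders `hN` (Lemma-3 numerics at the junction's arity
`(m₃+1, (ℓ₆+1)∕2)`), `hα`, `hPcard`, `hcount` of the kernel-tower junctions (VERBATIM 67RDL's, `lamD.toC.toK ↦ lamK`) can hold together only if the
constants record of the layer has `δ·κ` above `1280·M⁴·L³` (`≥ 655 360` at print's `L ≥ 8`): `10·M⁴L⁴ ≤ a₅` (`ten_mul_pow_le_a5_of_count_binders`) against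
`a₅ < δ·L·κ∕128` (`a5_lt_of_numerics_half`; `(c13OfRecord θ lamK.layer).δ ∕ .κ` ARE `lamK.c.δ ∕ .κ`).
[cite: Balaban1988RG2Cluster, (2.24)–(2.26) p.17, p.20 (before (2.37)), Lemma 3 p.20, p.21 (closing paragraph)] -/
theorem delta_kappa_floor_of_count_binders {a a₂ a₂' a₅ Aabs : ℝ}
    (hN : Lemma3Numerics (c13OfRecord θ lamK.layer) (lamK.layer.m₃ + 1) (((θ.ℓ₆ + 1 : ℕ) : ℝ) / 2) a a₂ a₂' a₅ Aabs)
    (hα : 0 < lamK.layer.c.α₄)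
    (hPcard : ∀ Z, ∀ t ∈ terms (θ.ℓ₆ + 1) (lamK.layer.m₃ + 1) Z, (lamK.Pl Z t).card = t.2.card)
    (hcount : ∀ Z, ∀ t ∈ terms (θ.ℓ₆ + 1) (lamK.layer.m₃ + 1) Z,
      2 * (Fintype.card (lamK.𝒦 Z t).Λ : ℝ) + (Fintype.card ((lamK.𝒦 Z t).Λ ⊕ (lamK.𝒦 Z t).C₀) : ℝ) / 2
        + 2 * (K₀ 64 8 * lamK.layer.c.α₄ * ((((t.1).image Subtype.val).biUnion id).card : ℝ)) ≤ a₅ * ((Z.1).card : ℝ)) :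
    1280 * (((lamK.m₃ : ℝ) + 1) ^ 4 * ((θ.ℓ₆ : ℝ) + 1) ^ 3) < lamK.c.δ * lamK.c.κ := by
  have h10 := ten_mul_pow_le_a5_of_count_binders θ lamK hα hPcard hcount
  have ha := a5_lt_of_numerics_half hN
  have hδ : (c13OfRecord θ lamK.layer).δ = lamK.c.δ := rfl
  have hκ : (c13OfRecord θ lamK.layer).κ = lamK.c.κ := rfl
  rw [hδ, hκ] at ha
  push_cast at ha
  have hL : (0 : ℝ) < (θ.ℓ₆ : ℝ) + 1 := by positivity
  -- `10 M⁴ L⁴ < δ L κ / 128`  ⟹  `1280 M⁴ L³ < δ κ`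
  have h1 : 10 * (((lamK.m₃ : ℝ) + 1) ^ 4 * ((θ.ℓ₆ : ℝ) + 1) ^ 4) < lamK.c.δ * ((θ.ℓ₆ : ℝ) + 1) * lamK.c.κ / 128 := lt_of_le_of_lt h10 ha
  have h2 : (1280 * (((lamK.m₃ : ℝ) + 1) ^ 4 * ((θ.ℓ₆ : ℝ) + 1) ^ 3)) * ((θ.ℓ₆ : ℝ) + 1)
      < (lamK.c.δ * lamK.c.κ) * ((θ.ℓ₆ : ℝ) + 1) := by
    have : (1280 * (((lamK.m₃ : ℝ) + 1) ^ 4 * ((θ.ℓ₆ : ℝ) + 1) ^ 3)) * ((θ.ℓ₆ : ℝ) + 1)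
        = 128 * (10 * (((lamK.m₃ : ℝ) + 1) ^ 4 * ((θ.ℓ₆ : ℝ) + 1) ^ 4)) := by ring
    rw [this]
    have : (lamK.c.δ * lamK.c.κ) * ((θ.ℓ₆ : ℝ) + 1) = 128 * (lamK.c.δ * ((θ.ℓ₆ : ℝ) + 1) * lamK.c.κ / 128) := by ring
    rw [this]
    linarith
  exact lt_of_mul_lt_mul_right h2 hL.le

open Classical in
/-- ★★★ **NO JOINT INHABITANT AT SMALL `δκ`.**  If the layer's constants record has `δ·κ ≤ 1280` then — whatever `θ`, the torus size, the bond fineness,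
the kernel records `𝒦`, the row-bond sets `Pl` and the letters `a a₂ a₂′ a₅ A_abs` — the junction's binders `hN`, `hα`, `hPcard`, `hcount` do not hold together
(`1280 ≤ 1280·M⁴·L³`).  [cite: Balaban1988RG2Cluster, (2.24)–(2.26) p.17, p.20 (before (2.37)), p.21 (closing paragraph)] -/
theorem count_binders_false_of_delta_kappa_le (hδκ : lamK.c.δ * lamK.c.κ ≤ 1280) {a a₂ a₂' a₅ Aabs : ℝ}
    (hN : Lemma3Numerics (c13OfRecord θ lamK.layer) (lamK.layer.m₃ + 1) (((θ.ℓ₆ + 1 : ℕ) : ℝ) / 2) a a₂ a₂' a₅ Aabs)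
    (hα : 0 < lamK.layer.c.α₄)
    (hPcard : ∀ Z, ∀ t ∈ terms (θ.ℓ₆ + 1) (lamK.layer.m₃ + 1) Z, (lamK.Pl Z t).card = t.2.card)
    (hcount : ∀ Z, ∀ t ∈ terms (θ.ℓ₆ + 1) (lamK.layer.m₃ + 1) Z,
      2 * (Fintype.card (lamK.𝒦 Z t).Λ : ℝ) + (Fintype.card ((lamK.𝒦 Z t).Λ ⊕ (lamK.𝒦 Z t).C₀) : ℝ) / 2
        + 2 * (K₀ 64 8 * lamK.layer.c.α₄ * ((((t.1).image Subtype.val).biUnion id).card : ℝ)) ≤ a₅ * ((Z.1).card : ℝ)) :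
    False := by
  have h := delta_kappa_floor_of_count_binders θ lamK hN hα hPcard hcount
  have hM : (1 : ℝ) ≤ ((lamK.m₃ : ℝ) + 1) ^ 4 := one_le_pow₀ (by linarith [(Nat.cast_nonneg lamK.m₃ : (0 : ℝ) ≤ lamK.m₃)])
  have hL : (1 : ℝ) ≤ ((θ.ℓ₆ : ℝ) + 1) ^ 3 := one_le_pow₀ (by linarith [(Nat.cast_nonneg θ.ℓ₆ : (0 : ℝ) ≤ θ.ℓ₆)])
  have hML : (1 : ℝ) ≤ ((lamK.m₃ : ℝ) + 1) ^ 4 * ((θ.ℓ₆ : ℝ) + 1) ^ 3 := by nlinarith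
  nlinarith

end Junction

/-! ## §4. At the tree's witness families (`δ = 3∕40`, `κ = κw = 20(κ₀(64,8) + 64)`): `δκ < 672`, hence no joint inhabitant -/

section Families

/-- `log 162 < 6` (`e⁶ > 2.718⁶ > 403`); private plumbing. [folklore] -/
private theorem log_162_lt_six : Real.log 162 < 6 := by
  rw [Real.log_lt_iff_lt_exp (by norm_num)]
  have h := Real.exp_one_gt_d9
  have h6 : (2.7182818283 : ℝ) ^ 6 < (Real.exp 1) ^ 6 := by
    exact pow_lt_pow_left₀ h (by norm_num) (by norm_num)
  have : (Real.exp 1) ^ 6 = Real.exp 6 := by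
    rw [← Real.exp_one_rpow]
    norm_num
  calc (162 : ℝ) < (2.7182818283 : ℝ) ^ 6 := by norm_num
    _ < (Real.exp 1) ^ 6 := h6
    _ = Real.exp 6 := this

/-- `κ₀(64, 8) = 64·log 162 < 384`; private plumbing. [folklore] -/
private theorem κ₀w_lt : κ₀w < 384 := by
  have h := TreeLengthCubeSystem.kappa₀_four
  norm_num at h
  show kappa₀ 64 8 < 384
  rw [h]
  have := log_162_lt_six
  linarith

/-- **The window ∕ torus witness rate is below `8960`**: `κw = 20(κ₀(64,8) + 64) < 20·(384 + 64)`.  The constants records `B13Lemma3TorusNonvacuity.consts`,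
`B13ChainJointNonvacuity226.constsQ8 M` and `B13ChainJointNonvacuityPrefactors.constsQ8A M α₄` all carry `κ := κw`.
[cite: Balaban1988RG2Cluster, p.21 (closing paragraph), bookkeeping on the tree's witness data] -/
theorem κw_lt : κw < 8960 := by
  have h := κ₀w_lt
  show 20 * (κ₀w + 64) < 8960
  linarith

/-- **`δw·κw < 672`** — the `δκ` of every numerics witness of the N10 chain (`δ = 3∕40` is pinned by R22 `(1 − 10δ)·½L = 1` at `L = 8`).
[cite: Balaban1988RG2Cluster, p.21 (closing paragraph: R22 and the choice of δ), bookkeeping on the tree's witness data] -/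
theorem δw_mul_κw_lt : δw * κw < 672 := by
  have h := κw_lt
  show (3 / 40 : ℝ) * κw < 672
  linarith

variable (θ : Stage3Params) (lamK : ResidB13K θ)

open Classical in
/-- ★★★ **NO JOINT INHABITANT OF THE JUNCTION AT THE WITNESS CONSTANTS.**  For a kernel tower whose constants record has the witness values `δ = δw = 3∕40`
and `κ = κw` (every A6 witness of the chain: `consts`, `constsQ8 M`, `constsQ8A M α₄`) there are NO letters `a a₂ a₂′ a₅ A_abs` meeting the junction's
`hN ∧ hα ∧ hPcard ∧ hcount` — for every `θ`, every torus size `n`, every bond fineness `m₃`, every kernel family `𝒦` and every choice of the row-bond sets.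
So the tree's «joint numerical witnesses» of 67 ∕ 67R ∕ 67RD ∕ 67RDL sit at constants where the junction's OBJECT binders `hPcard ∧ hcount` cannot be met
by any tower: `δw·κw < 672 ≤ 1280`.  (A statement about the typed lists; p. 20's count is dial-weighted.)
[cite: Balaban1988RG2Cluster, (2.24)–(2.26) p.17, p.20 (before (2.37)), p.21 (closing paragraph)] -/
theorem no_joint_inhabitant_of_witness_constants (hδ : lamK.c.δ = δw) (hκ : lamK.c.κ = κw) :
    ¬ ∃ a a₂ a₂' a₅ Aabs : ℝ,
      Lemma3Numerics (c13OfRecord θ lamK.layer) (lamK.layer.m₃ + 1) (((θ.ℓ₆ + 1 : ℕ) : ℝ) / 2) a a₂ a₂' a₅ Aabs ∧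
      0 < lamK.layer.c.α₄ ∧
      (∀ Z, ∀ t ∈ terms (θ.ℓ₆ + 1) (lamK.layer.m₃ + 1) Z, (lamK.Pl Z t).card = t.2.card) ∧
      (∀ Z, ∀ t ∈ terms (θ.ℓ₆ + 1) (lamK.layer.m₃ + 1) Z,
        2 * (Fintype.card (lamK.𝒦 Z t).Λ : ℝ) + (Fintype.card ((lamK.𝒦 Z t).Λ ⊕ (lamK.𝒦 Z t).C₀) : ℝ) / 2
          + 2 * (K₀ 64 8 * lamK.layer.c.α₄ * ((((t.1).image Subtype.val).biUnion id).card : ℝ)) ≤ a₅ * ((Z.1).card : ℝ)) := by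
  rintro ⟨a, a₂, a₂', a₅, Aabs, hN, hα, hPcard, hcount⟩
  have hδκ : lamK.c.δ * lamK.c.κ ≤ 1280 := by
    rw [hδ, hκ]
    have := δw_mul_κw_lt
    linarith
  exact count_binders_false_of_delta_kappa_le θ lamK hδκ hN hα hPcard hcount

open Classical in
/-- **At lit-balaban's witness record `consts`** (`B13Lemma3TorusNonvacuity`, L = 8, `a₅ = ½` in `numerics_nonvacuous_pos`): no joint inhabitant.
[cite: Balaban1988RG2Cluster, p.21 (closing paragraph)] -/
theorem no_joint_inhabitant_of_consts (hc : lamK.c = consts) :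
    ¬ ∃ a a₂ a₂' a₅ Aabs : ℝ,
      Lemma3Numerics (c13OfRecord θ lamK.layer) (lamK.layer.m₃ + 1) (((θ.ℓ₆ + 1 : ℕ) : ℝ) / 2) a a₂ a₂' a₅ Aabs ∧
      0 < lamK.layer.c.α₄ ∧
      (∀ Z, ∀ t ∈ terms (θ.ℓ₆ + 1) (lamK.layer.m₃ + 1) Z, (lamK.Pl Z t).card = t.2.card) ∧
      (∀ Z, ∀ t ∈ terms (θ.ℓ₆ + 1) (lamK.layer.m₃ + 1) Z,
        2 * (Fintype.card (lamK.𝒦 Z t).Λ : ℝ) + (Fintype.card ((lamK.𝒦 Z t).Λ ⊕ (lamK.𝒦 Z t).C₀) : ℝ) / 2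
          + 2 * (K₀ 64 8 * lamK.layer.c.α₄ * ((((t.1).image Subtype.val).biUnion id).card : ℝ)) ≤ a₅ * ((Z.1).card : ℝ)) :=
  no_joint_inhabitant_of_witness_constants θ lamK (by rw [hc]; rfl) (by rw [hc]; rfl)

open Classical in
/-- **At n10-w1's record `constsQ8 M`** (`B13ChainJointNonvacuity226.chain_joint_nonvacuous_226`'s family): no joint inhabitant, for every `M`.
[cite: Balaban1988RG2Cluster, p.21 (closing paragraph)] -/
theorem no_joint_inhabitant_of_constsQ8 {M : ℝ} (hc : lamK.c = constsQ8 M) :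
    ¬ ∃ a a₂ a₂' a₅ Aabs : ℝ,
      Lemma3Numerics (c13OfRecord θ lamK.layer) (lamK.layer.m₃ + 1) (((θ.ℓ₆ + 1 : ℕ) : ℝ) / 2) a a₂ a₂' a₅ Aabs ∧
      0 < lamK.layer.c.α₄ ∧
      (∀ Z, ∀ t ∈ terms (θ.ℓ₆ + 1) (lamK.layer.m₃ + 1) Z, (lamK.Pl Z t).card = t.2.card) ∧
      (∀ Z, ∀ t ∈ terms (θ.ℓ₆ + 1) (lamK.layer.m₃ + 1) Z,
        2 * (Fintype.card (lamK.𝒦 Z t).Λ : ℝ) + (Fintype.card ((lamK.𝒦 Z t).Λ ⊕ (lamK.𝒦 Z t).C₀) : ℝ) / 2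
          + 2 * (K₀ 64 8 * lamK.layer.c.α₄ * ((((t.1).image Subtype.val).biUnion id).card : ℝ)) ≤ a₅ * ((Z.1).card : ℝ)) :=
  no_joint_inhabitant_of_witness_constants θ lamK (by rw [hc]; rfl) (by rw [hc]; rfl)

open Classical in
/-- **At this seat's record `constsQ8A M α₄`** (`B13ChainJointNonvacuityPrefactors.junction_numerals_joint_witness(_of_activity)(_bond)`'s family — the
joint witness of ALL NUMERICAL binders of 67RD): no joint inhabitant, for every `M` and every activity letter `α₄`.  The numerical witnesses of record
and the junction's object binders `hPcard ∧ hcount` are INCOMPATIBLE as typed. [cite: Balaban1988RG2Cluster, p.21 (closing paragraph)] -/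
theorem no_joint_inhabitant_of_constsQ8A {M α₄ : ℝ} (hc : lamK.c = constsQ8A M α₄) :
    ¬ ∃ a a₂ a₂' a₅ Aabs : ℝ,
      Lemma3Numerics (c13OfRecord θ lamK.layer) (lamK.layer.m₃ + 1) (((θ.ℓ₆ + 1 : ℕ) : ℝ) / 2) a a₂ a₂' a₅ Aabs ∧
      0 < lamK.layer.c.α₄ ∧
      (∀ Z, ∀ t ∈ terms (θ.ℓ₆ + 1) (lamK.layer.m₃ + 1) Z, (lamK.Pl Z t).card = t.2.card) ∧
      (∀ Z, ∀ t ∈ terms (θ.ℓ₆ + 1) (lamK.layer.m₃ + 1) Z,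
        2 * (Fintype.card (lamK.𝒦 Z t).Λ : ℝ) + (Fintype.card ((lamK.𝒦 Z t).Λ ⊕ (lamK.𝒦 Z t).C₀) : ℝ) / 2
          + 2 * (K₀ 64 8 * lamK.layer.c.α₄ * ((((t.1).image Subtype.val).biUnion id).card : ℝ)) ≤ a₅ * ((Z.1).card : ℝ)) :=
  no_joint_inhabitant_of_witness_constants θ lamK (by rw [hc]; rfl) (by rw [hc]; rfl)

end Families

/-! ## §5. The located repair in kernel form: a DIAL-WEIGHTED count is met for arbitrary object sizes at small dials -/

section Repair

/-- ★ **A DIAL-WEIGHTED COUNT HOLDS FOR ANY OBJECT SIZES ONCE THE DIALS ARE SMALL** — the shape of 51C's `hvol` ∕ of the LEFT side of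
`B13Bound226Numerals.vol_of_counts` (coefficients `u₁, u₂, u₃` that are the junction's dials: `∝ θ₀`, `α₅·c_E`-type, `2K₀α₄`): for every volume rate
`a₅ > 0`, every `|Z| ≥ 1` and every finite sizes `Λc, ΛCc, Uc ≥ 0`, the count `u₁·Λc + u₂·ΛCc + u₃·Uc ≤ a₅·|Z|` holds as soon as each dial is at most
`a₅ ∕ (3·(size + 1))`.  With the dial-weighted binder displayed (and `θ₀ ≤ θ₀max` free) the count no longer pins `δκ`; p. 20: *"O(1)(LM)⁴α₅ … sufficiently
small"* — the smallness is the dial's, not the object's. [cite: Balaban1988RG2Cluster, (2.24)–(2.26) p.17, p.20 (before (2.37))] -/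
theorem dialCount_le_of_dials {a₅ Zc Λc ΛCc Uc u₁ u₂ u₃ : ℝ} (ha : 0 < a₅) (hZ : 1 ≤ Zc) (hΛ : 0 ≤ Λc) (hΛC : 0 ≤ ΛCc) (hU : 0 ≤ Uc)
    (hu₁ : 0 ≤ u₁) (hu₂ : 0 ≤ u₂) (hu₃ : 0 ≤ u₃)
    (h₁ : u₁ ≤ a₅ / (3 * (Λc + 1))) (h₂ : u₂ ≤ a₅ / (3 * (ΛCc + 1))) (h₃ : u₃ ≤ a₅ / (3 * (Uc + 1))) :
    u₁ * Λc + u₂ * ΛCc + u₃ * Uc ≤ a₅ * Zc := by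
  have k₁ : u₁ * Λc ≤ a₅ / 3 := by
    have hpos : (0 : ℝ) < 3 * (Λc + 1) := by positivity
    have : u₁ * (3 * (Λc + 1)) ≤ a₅ := (le_div_iff₀ hpos).1 h₁
    nlinarith
  have k₂ : u₂ * ΛCc ≤ a₅ / 3 := by
    have hpos : (0 : ℝ) < 3 * (ΛCc + 1) := by positivity
    have : u₂ * (3 * (ΛCc + 1)) ≤ a₅ := (le_div_iff₀ hpos).1 h₂
    nlinarith
  have k₃ : u₃ * Uc ≤ a₅ / 3 := by
    have hpos : (0 : ℝ) < 3 * (Uc + 1) := by positivity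
    have : u₃ * (3 * (Uc + 1)) ≤ a₅ := (le_div_iff₀ hpos).1 h₃
    nlinarith
  nlinarith

/-- **…whereas the θ-FREE form cannot be rescued by any dial**: with coefficients frozen at `2` and `½` the count reads `2Λc + ½ΛCc + u₃Uc ≤ a₅|Z|`,
false as soon as `Λc > a₅|Z|∕2` — at the universal term `Λc ≥ 4(ML(n+1))⁴` against `|Z| = (n+1)⁴` (§3).  The two lemmas together locate the
repair: display the dial-weighted count. [cite: Balaban1988RG2Cluster, (2.24)–(2.26) p.17, p.20 (before (2.37))] -/
theorem frozenCount_false_of_lt {a₅ Zc Λc ΛCc Uc u₃ : ℝ} (hΛC : 0 ≤ ΛCc) (hU : 0 ≤ Uc) (hu₃ : 0 ≤ u₃) (hbig : a₅ * Zc < 2 * Λc) :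
    ¬ (2 * Λc + ΛCc / 2 + u₃ * Uc ≤ a₅ * Zc) := by
  intro h
  have : 0 ≤ u₃ * Uc := mul_nonneg hu₃ hU
  linarith

end Repair

end Literature.MathematicalPhysics.QuantumFieldTheory.Balaban1983to89.B13CountBinderObstruction

end
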